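import Mathlib
import Summits.CriticalPhenomena.PercolationContinuityZ3.Theorems.PercNearOneGluingNoHeavyQuantTwoArcRegimeA
import HarnessLib

/-!
# QUANT lane R8, "FAR beyond trees", layer one on hairy cycles — the pairs inequality with SURE companions (hair weights `h ∈ [0,1]`, w-form)

builds on p205010 (kernel theorem, internal audit signed; external expert review pending)

Support file (`--supports stmt-CriticalPhenomena-4575`), seat `prim-quant-p1` (gen 17); memo `quant/prim-quant-p1-g17/FOR-LEAD-TWOCHAIN-B.md` §6.
Continues `…QuantTwoArcPairs` / `…QuantTwoArcRegimeA` (odds coordinates, hairs `< 1`).  Companions are now given by hair WEIGHTS (`HComp = (A, c, h)`,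
`T = hρ`), so SURE companions (`h = 1`: weight-1 hairs, several relays on one cycle vertex) are covered, and the pairs polynomial is taken in its
`Z`-multiplied polynomial form `F = P₂ − P₁ − x·Z` (`zW = ∏(1−h)`, `p1W = Σ_k h_k e_k ∏_{l≠k}(1−h_l)`, `p2W = Σ_{j<k} h_j h_k Φ_jk ∏_{l≠j,k}(1−h_l)`,
`s1W`, `FW`) — `F = Σ_{|Q| ≤ 2} w(Q)Φ(Q)`, the part of `P(N ≥ 2) − x = Σ_Q w(Q)Φ(Q)` with at most two open companion hairs (the rest is `≥ 0` termwise),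
which is what the law-level bridge over prim-cert-1's `sunLaw` consumes.
* conversions for hairs `< 1`: `FW_eq` (`F = Z·(Π − ℬ − x)`), `p1W_eq`, `p2W_eq`, `s1W_eq`, `sigS_map`, `HComp.Adm.toComp`;
* sure companions: `zW_eq_zero`, `p1W_two_sure`, `s1W_sure`, **`FW_one_sure`** (one sure companion `k`: `F = Z(js)Z(ls)·C_k`, `C_k` its coefficient);
* `Quant.TwoArc.FW_nonneg` — **THE PAIRS INEQUALITY IN REGIME A WITH SURE COMPANIONS**: `0 ≤ p ≤ 1`, `c₁ ≤ 1`, non-empty nearest-first list, `h ∈ [0,1]`,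
  `x ≤ hρ`, `A` non-decreasing, `c` non-increasing, `Σ hρ ≥ 1` ⟹ `F ≥ 0` (no sure companion: `pairs_regimeA`; two or more: `P₁ = Z = 0 ≤ P₂`; exactly
  one, `k`: `C_k ≥ 0` by Lemma C if `k` is nearest, by `u_phi_ge_e` otherwise).
NOT here: the dictionary `sunLaw ↔ (p, c₁, (A, c, h))` and the `SunFAR K 1` assembly on the sure-argmin region; the tied-random relay (open).  [this work]
-/

namespace Summit.CriticalPhenomena.PercolationContinuityZ3.Theorems

namespace Quant

namespace TwoArc

/-! ## Companions given by hair WEIGHTS `h ∈ [0,1]` (sure companions `h = 1` allowed) and the `Z`-multiplied ("w-form") pairs polynomial -/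

/-- A companion given by its hair weight: prefix drop `A`, suffix failure `c`, hair `h ∈ [0,1]` (`T = h ρ`, odds `h/(1−h)` when `h < 1`). [this work] -/
structure HComp where
  /-- prefix drop `α₁ − α_k` -/ A : ℝ
  /-- suffix failure `1 − β_k` -/ c : ℝ
  /-- hair weight `h_k` -/ h : ℝ

variable (p c₁ : ℝ)
namespace HComp
/-- Coverage probability of the position, `ρ = 1 − (p + A) c`. [this work] -/
def rho (k : HComp) : ℝ := 1 - (p + k.A) * k.c

/-- The companion in odds coordinates: `T = h ρ`, `u = h/(1 − h)` (junk `u` when `h = 1`; only used for `h < 1`). [this work] -/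
noncomputable def toComp (k : HComp) : Comp := ⟨k.A, k.c, k.h * k.rho p, k.h / (1 - k.h)⟩

/-- Admissibility by hair weight: box constraints, `0 ≤ h ≤ 1`, and `x ≤ T = h ρ`. [this work] -/
structure Adm (k : HComp) : Prop where
  A_nonneg : 0 ≤ k.A
  A_le : k.A ≤ 1 - p
  c_nonneg : 0 ≤ k.c
  c_le : k.c ≤ c₁
  h_nonneg : 0 ≤ k.h
  h_le : k.h ≤ 1
  x_le_T : xv p c₁ ≤ k.h * k.rho p
end HComp

/-- `Z = ∏ (1 − h)`. [this work] -/
def zW : List HComp → ℝ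
  | [] => 1 | k :: ks => (1 - k.h) * zW ks

/-- `Z`-weighted pair income of `k` from the later companions: `Σ_l h_l Φ_kl ∏_{m ≠ l} (1 − h_m)`. [this work] -/
noncomputable def s1W (k : HComp) : List HComp → ℝ
  | [] => 0 | l :: ls => l.h * Comp.phi p c₁ (k.toComp p) (l.toComp p) * zW ls + (1 - l.h) * s1W k ls

/-- `Z`-weighted singletons `Σ_k h_k e_k ∏_{l ≠ k}(1 − h_l)` (= `Σ_{|Q|=1} w(Q) e`). [this work] -/
def p1W : List HComp → ℝ
  | [] => 0 | k :: ks => k.h * (k.A * k.c) * zW ks + (1 - k.h) * p1W ks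

/-- `Z`-weighted pairs `Σ_{j<k} h_j h_k Φ_jk ∏_{l ≠ j,k}(1 − h_l)` (= `Σ_{|Q|=2} w(Q) Φ(Q)`). [this work] -/
noncomputable def p2W : List HComp → ℝ
  | [] => 0 | k :: ks => (1 - k.h) * p2W ks + k.h * s1W p c₁ k ks

/-- Mass `σ = Σ h ρ`. [this work] -/
def sigW (ks : List HComp) : ℝ := (ks.map fun k => k.h * k.rho p).sum

/-- **The w-form pairs polynomial** `F = Σ_{|Q| ≤ 2} w(Q) Φ(Q) = P₂ − P₁ − x Z` (for hairs `< 1` it is `Z·(Π − ℬ − x)`). [this work] -/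
noncomputable def FW (ks : List HComp) : ℝ := p2W p c₁ ks - p1W ks - xv p c₁ * zW ks
variable {p c₁}
section basic
/-- `Z` recursion. [this work] -/
@[simp] theorem zW_cons (k : HComp) (ks : List HComp) : zW (k :: ks) = (1 - k.h) * zW ks := rfl
/-- `Z` of the empty list. [this work] -/
@[simp] theorem zW_nil : zW [] = 1 := rfl
/-- `σ` recursion. [this work] -/
@[simp] theorem sigW_cons (k : HComp) (ks : List HComp) : sigW p (k :: ks) = k.h * k.rho p + sigW p ks := by simp [sigW]
/-- `σ` of the empty list. [this work] -/
@[simp] theorem sigW_nil : sigW p ([] : List HComp) = 0 := by simp [sigW]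
/-- `Z ≥ 0`. [this work] -/
theorem zW_nonneg {ks : List HComp} (h : ∀ k ∈ ks, HComp.Adm p c₁ k) : 0 ≤ zW ks := by
  induction ks with
  | nil => simp
  | cons k ks ih => rw [zW_cons]; exact mul_nonneg (by linarith [(h k (by simp)).h_le]) (ih fun l hl => h l (by simp [hl]))
/-- `Z > 0` when every hair is `< 1`. [this work] -/
theorem zW_pos {ks : List HComp} (h : ∀ k ∈ ks, k.h < 1) : 0 < zW ks := by
  induction ks with
  | nil => simp
  | cons k ks ih => rw [zW_cons]; exact mul_pos (by linarith [h k (by simp)]) (ih fun l hl => h l (by simp [hl]))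
/-- `Z = 0` when some hair is sure. [this work] -/
theorem zW_eq_zero {ks : List HComp} {k : HComp} (hk : k ∈ ks) (h1 : k.h = 1) : zW ks = 0 := by
  induction ks with
  | nil => simp at hk
  | cons l ls ih =>
    rw [zW_cons]
    rcases List.mem_cons.mp hk with rfl | hk'
    · simp [h1]
    · simp [ih hk']

/-- `0 ≤ ρ ≤ 1`, `hρ ≤ ρ` and `d ≥ 0` for an admissible companion. [this work] -/
theorem HComp.Adm.rho_le {k : HComp} (hk : HComp.Adm p c₁ k) (hp : 0 ≤ p) : k.rho p ≤ 1 := by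
  have : 0 ≤ (p + k.A) * k.c := mul_nonneg (by linarith [hk.A_nonneg]) hk.c_nonneg
  simp only [HComp.rho]; linarith
/-- `ρ ≥ 0`. [this work] -/
theorem HComp.Adm.rho_nonneg {k : HComp} (hk : HComp.Adm p c₁ k) (hc₁1 : c₁ ≤ 1) : 0 ≤ k.rho p := by
  have h1 : (p + k.A) * k.c ≤ 1 * 1 :=
    mul_le_mul (by linarith [hk.A_le]) (le_trans hk.c_le hc₁1) hk.c_nonneg (by norm_num)
  simp only [HComp.rho]; linarith
/-- `hρ ≤ ρ`. [this work] -/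
theorem HComp.Adm.T_le {k : HComp} (hk : HComp.Adm p c₁ k) (hc₁1 : c₁ ≤ 1) : k.h * k.rho p ≤ k.rho p := by
  have := mul_le_mul_of_nonneg_right hk.h_le (hk.rho_nonneg hc₁1)
  linarith
/-- `d ≥ 0`. [this work] -/
theorem HComp.Adm.d_nonneg {k : HComp} (hk : HComp.Adm p c₁ k) (hc₁1 : c₁ ≤ 1) : 0 ≤ (k.toComp p).d p c₁ := by
  have h1 := hk.x_le_T; have h2 := hk.T_le hc₁1
  show 0 ≤ p * (c₁ - k.c) - k.A * k.c
  simp only [HComp.rho, xv] at h1 h2; nlinarith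

/-- A companion with `h < 1` is admissible in odds coordinates. [this work] -/
theorem HComp.Adm.toComp {k : HComp} (hk : HComp.Adm p c₁ k) (hc₁1 : c₁ ≤ 1) (hh : k.h < 1) :
    Comp.Adm p c₁ (k.toComp p) where
  A_nonneg := hk.A_nonneg
  A_le := hk.A_le
  c_nonneg := hk.c_nonneg
  c_le := hk.c_le
  u_nonneg := div_nonneg hk.h_nonneg (by linarith)
  x_le_T := hk.x_le_T
  T_le_rho := by
    show k.h * k.rho p ≤ 1 - (p + k.A) * k.c
    simpa [HComp.rho] using hk.T_le hc₁1
  odds := by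
    show k.h / (1 - k.h) * ((1 - (p + k.A) * k.c) - k.h * k.rho p) = k.h * k.rho p
    have h1 : (1 - k.h) ≠ 0 := by linarith
    have e1 : (1 - (p + k.A) * k.c) - k.h * k.rho p = (1 - k.h) * k.rho p := by simp only [HComp.rho]; ring
    rw [e1, ← mul_assoc, div_mul_cancel₀ _ h1]

/-- The `Z`-weighted income is non-negative (pair values `≥ 0` when `c` does not increase). [this work] -/
theorem s1W_nonneg (hc₁1 : c₁ ≤ 1) (k : HComp) (hk : HComp.Adm p c₁ k) {ks : List HComp}
    (h : ∀ l ∈ ks, HComp.Adm p c₁ l) (hc : ∀ l ∈ ks, l.c ≤ k.c) : 0 ≤ s1W p c₁ k ks := by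
  induction ks with
  | nil => simp [s1W]
  | cons l ls ih =>
    have hl := h l (by simp)
    have ih' := ih (fun m hm => h m (by simp [hm])) (fun m hm => hc m (by simp [hm]))
    have hphi : 0 ≤ Comp.phi p c₁ (k.toComp p) (l.toComp p) := by
      have := hk.d_nonneg hc₁1
      show 0 ≤ (k.toComp p).d p c₁ + k.A * (k.c - l.c)
      exact add_nonneg this (mul_nonneg hk.A_nonneg (by linarith [hc l (by simp)]))
    simp only [s1W]
    have := zW_nonneg (ks := ls) (fun m hm => h m (by simp [hm]))
    have : 0 ≤ l.h * Comp.phi p c₁ (k.toComp p) (l.toComp p) * zW ls := mul_nonneg (mul_nonneg hl.h_nonneg hphi) this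
    nlinarith [hl.h_le]

/-- The `Z`-weighted pairs are non-negative. [this work] -/
theorem p2W_nonneg (hc₁1 : c₁ ≤ 1) {ks : List HComp} (h : ∀ k ∈ ks, HComp.Adm p c₁ k)
    (hc : ks.Pairwise (fun j k => k.c ≤ j.c)) : 0 ≤ p2W p c₁ ks := by
  induction ks with
  | nil => simp [p2W]
  | cons k ks ih =>
    have hk := h k (by simp)
    rcases List.pairwise_cons.mp hc with ⟨hkc, hc'⟩
    have h1 := ih (fun l hl => h l (by simp [hl])) hc'
    have h2 := s1W_nonneg hc₁1 k hk (fun l hl => h l (by simp [hl])) hkc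
    simp only [p2W]; nlinarith [hk.h_le, hk.h_nonneg]

end basic

section finite
/-- Conversion to odds coordinates for hairs `< 1`: `σ`. [this work] -/
theorem sigS_map (ks : List HComp) : sigS (ks.map (HComp.toComp p)) = sigW p ks := by
  induction ks with
  | nil => simp
  | cons k ks ih => simp [sigS_cons, ih, HComp.toComp]

/-- Conversion: `s1W k ks = Z(ks) · I_k`. [this work] -/
theorem s1W_eq (k : HComp) {ks : List HComp} (h : ∀ l ∈ ks, l.h < 1) :
    s1W p c₁ k ks = zW ks * inc p c₁ (k.toComp p) (ks.map (HComp.toComp p)) := by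
  induction ks with
  | nil => simp [s1W]
  | cons l ls ih =>
    have hl : 1 - l.h ≠ 0 := by linarith [h l (by simp)]
    have ih' := ih (fun m hm => h m (by simp [hm]))
    simp only [s1W, List.map_cons, inc_cons, zW_cons, ih']
    have hu : (l.toComp p).u = l.h / (1 - l.h) := rfl
    have key : l.h = (l.toComp p).u * (1 - l.h) := by rw [hu, div_mul_cancel₀ _ hl]
    linear_combination (Comp.phi p c₁ (k.toComp p) (l.toComp p) * zW ls) * key

/-- Conversion: `P₁ = Z · ℬ`. [this work] -/
theorem p1W_eq {ks : List HComp} (h : ∀ l ∈ ks, l.h < 1) : p1W ks = zW ks * bS (ks.map (HComp.toComp p)) := by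
  induction ks with
  | nil => simp [p1W]
  | cons l ls ih =>
    have hl : 1 - l.h ≠ 0 := by linarith [h l (by simp)]
    have ih' := ih (fun m hm => h m (by simp [hm]))
    simp only [p1W, List.map_cons, bS_cons, zW_cons, ih']
    have hu : (l.toComp p).u = l.h / (1 - l.h) := rfl
    have he : (l.toComp p).e = l.A * l.c := rfl
    have key : l.h = (l.toComp p).u * (1 - l.h) := by rw [hu, div_mul_cancel₀ _ hl]
    rw [he]
    linear_combination (l.A * l.c * zW ls) * key

/-- Conversion: `P₂ = Z · Π`. [this work] -/
theorem p2W_eq {ks : List HComp} (h : ∀ l ∈ ks, l.h < 1) : p2W p c₁ ks = zW ks * piS p c₁ (ks.map (HComp.toComp p)) := by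
  induction ks with
  | nil => simp [p2W]
  | cons l ls ih =>
    have hl : 1 - l.h ≠ 0 := by linarith [h l (by simp)]
    have ih' := ih (fun m hm => h m (by simp [hm]))
    have hs := s1W_eq (p := p) (c₁ := c₁) l (ks := ls) (fun m hm => h m (List.mem_cons_of_mem _ hm))
    simp only [p2W, List.map_cons, piS_cons, zW_cons, ih', hs]
    have hu : (l.toComp p).u = l.h / (1 - l.h) := rfl
    have key : l.h = (l.toComp p).u * (1 - l.h) := by rw [hu, div_mul_cancel₀ _ hl]
    linear_combination (zW ls * inc p c₁ (l.toComp p) (ls.map (HComp.toComp p))) * key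

/-- Conversion: `F = Z · (Π − ℬ − x)` when every hair is `< 1`. [this work] -/
theorem FW_eq {ks : List HComp} (h : ∀ l ∈ ks, l.h < 1) :
    FW p c₁ ks = zW ks * (piS p c₁ (ks.map (HComp.toComp p)) - bS (ks.map (HComp.toComp p)) - xv p c₁) := by
  simp only [FW, p2W_eq h, p1W_eq (p := p) h]; ring

end finite

section sure
/-- With a sure companion `k` inside, the `Z`-weighted income of an earlier `j` is `Φ_jk · Z(js) · Z(ls)` (others finite). [this work] -/
theorem s1W_sure (j k : HComp) (hk : k.h = 1) (js ls : List HComp) (hjs : ∀ m ∈ js, m.h < 1) :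
    s1W p c₁ j (js ++ k :: ls) = Comp.phi p c₁ (j.toComp p) (k.toComp p) * zW js * zW ls := by
  induction js with
  | nil => simp [s1W, hk]
  | cons m ms ih =>
    have ih' := ih (fun n hn => hjs n (by simp [hn]))
    simp only [List.cons_append, s1W, ih', zW_cons]
    rw [zW_eq_zero (ks := ms ++ k :: ls) (k := k) (by simp) hk]
    ring

/-- Two sure companions kill the singletons: `P₁ = 0`. [this work] -/
theorem p1W_two_sure (k : HComp) (hk : k.h = 1) (js ls : List HComp) (h2 : ∃ l ∈ js ++ ls, l.h = 1) :
    p1W (js ++ k :: ls) = 0 := by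
  induction js with
  | nil =>
    obtain ⟨l, hl, hl1⟩ := h2
    simp only [List.nil_append] at hl
    simp [p1W, hk, zW_eq_zero hl hl1]
  | cons m ms ih =>
    simp only [List.cons_append, p1W]
    rw [zW_eq_zero (ks := ms ++ k :: ls) (k := k) (by simp) hk]
    obtain ⟨l, hl, hl1⟩ := h2
    simp only [List.cons_append, List.mem_cons, List.mem_append] at hl
    rcases hl with rfl | hl | hl
    · simp [hl1]
    · rw [ih ⟨l, by simp [hl], hl1⟩]; ring
    · rw [ih ⟨l, by simp [hl], hl1⟩]; ring

/-- **One sure companion**: `F = Z(js)·Z(ls)·C_k` with `C_k = Σ_{j ∈ js} u_j Φ_jk + I_k(ls) − e_k` (the coefficient of the sure companion). [this work] -/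
theorem FW_one_sure (k : HComp) (hk : k.h = 1) (ls : List HComp) (hls : ∀ m ∈ ls, m.h < 1) :
    ∀ js : List HComp, (∀ m ∈ js, m.h < 1) →
      FW p c₁ (js ++ k :: ls) = zW js * zW ls *
        ((js.map fun j => (j.toComp p).u * Comp.phi p c₁ (j.toComp p) (k.toComp p)).sum
          + inc p c₁ (k.toComp p) (ls.map (HComp.toComp p)) - k.A * k.c) := by
  intro js
  induction js with
  | nil =>
    intro _
    simp only [FW, List.nil_append, p2W, p1W, zW_cons, hk, List.map_nil, List.sum_nil, zW_nil]
    rw [s1W_eq k hls]; ring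
  | cons j js ih =>
    intro hjs
    have hj : 1 - j.h ≠ 0 := by linarith [hjs j (by simp)]
    have ih' := ih (fun m hm => hjs m (by simp [hm]))
    have hrec : FW p c₁ (j :: (js ++ k :: ls)) = (1 - j.h) * FW p c₁ (js ++ k :: ls)
        + j.h * (s1W p c₁ j (js ++ k :: ls) - j.A * j.c * zW (js ++ k :: ls)) := by
      simp only [FW, p2W, p1W, zW_cons]; ring
    rw [List.cons_append, hrec, ih', s1W_sure j k hk js ls (fun m hm => hjs m (by simp [hm])),
      zW_eq_zero (ks := js ++ k :: ls) (k := k) (by simp) hk]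
    simp only [List.map_cons, List.sum_cons, zW_cons]
    have hu : (j.toComp p).u = j.h / (1 - j.h) := rfl
    have key : j.h = (j.toComp p).u * (1 - j.h) := by rw [hu, div_mul_cancel₀ _ hj]
    linear_combination (zW js * zW ls * Comp.phi p c₁ (j.toComp p) (k.toComp p)) * key

end sure

/-- The coefficient of a sure companion `k` that has a nearer finite companion is `≥ 0` (any nearer `j` pays `e_k`, `u_phi_ge_e`),
whatever the masses. [this work] -/
theorem sure_coeff_nonneg_of_nearer (hp1 : p ≤ 1) (hc₁1 : c₁ ≤ 1) (k : HComp) (hk : HComp.Adm p c₁ k)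
    (js ls : List HComp) (hjs : ∀ m ∈ js, m.h < 1) (hls : ∀ m ∈ ls, m.h < 1) (hne : js ≠ [])
    (hadm : ∀ m ∈ js ++ ls, HComp.Adm p c₁ m) (hcjs : ∀ j ∈ js, k.c ≤ j.c) (hcls : ∀ m ∈ ls, m.c ≤ k.c) :
    0 ≤ (js.map fun j => (j.toComp p).u * Comp.phi p c₁ (j.toComp p) (k.toComp p)).sum
        + inc p c₁ (k.toComp p) (ls.map (HComp.toComp p)) - k.A * k.c := by
  have hkd : 0 ≤ (k.toComp p).d p c₁ := hk.d_nonneg hc₁1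
  have hadm_ls : ∀ l ∈ ls.map (HComp.toComp p), Comp.Adm p c₁ l := by
    intro l hl; obtain ⟨m, hm, rfl⟩ := List.mem_map.mp hl; exact (hadm m (by simp [hm])).toComp hc₁1 (hls m hm)
  have hc_ls : ∀ l ∈ ls.map (HComp.toComp p), l.c ≤ (k.toComp p).c := by
    intro l hl; obtain ⟨m, hm, rfl⟩ := List.mem_map.mp hl; exact hcls m hm
  have hinc := inc_nonneg (k.toComp p) hk.A_nonneg hkd (ls.map (HComp.toComp p)) hadm_ls hc_ls
  have hterm : ∀ j ∈ js, k.A * k.c ≤ (j.toComp p).u * Comp.phi p c₁ (j.toComp p) (k.toComp p) := fun j hj =>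
    u_phi_ge_e hp1 hc₁1 (j.toComp p) (k.toComp p) ((hadm j (by simp [hj])).toComp hc₁1 (hjs j hj)) hk.A_le hk.c_nonneg
      hk.c_le (hcjs j hj)
  have hex : 0 ≤ k.A * k.c := mul_nonneg hk.A_nonneg hk.c_nonneg
  obtain ⟨j, js', rfl⟩ := List.exists_cons_of_ne_nil hne
  simp only [List.map_cons, List.sum_cons]
  have h1 := hterm j (by simp)
  have h2 : 0 ≤ (js'.map fun j => (j.toComp p).u * Comp.phi p c₁ (j.toComp p) (k.toComp p)).sum := List.sum_nonneg
    (by intro y hy; obtain ⟨m, hm, rfl⟩ := List.mem_map.mp hy; exact le_trans hex (hterm m (by simp [hm])))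
  linarith

/-- **THE w-FORM PAIRS INEQUALITY IN REGIME A, sure companions allowed.**  For `0 ≤ p ≤ 1`, `c₁ ≤ 1`, a non-empty nearest-first list of companions
admissible by hair weight (`h ∈ [0,1]`, `x ≤ hρ`), `A` non-decreasing, `c` non-increasing, `σ = Σ hρ ≥ 1`:
`F = Σ_{|Q| ≤ 2} w(Q) Φ(Q) = P₂ − P₁ − xZ ≥ 0`.  Cases: no sure companion (`Z·(Π − ℬ − x)`, `pairs_regimeA`); two or more (`P₁ = Z = 0 ≤ P₂`);
exactly one, `k` (`F = Z(js)Z(ls)·C_k`, and `C_k ≥ 0` by Lemma C when `k` is the nearest, by `u_phi_ge_e` otherwise). [this work] -/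
theorem FW_nonneg (hp : 0 ≤ p) (hp1 : p ≤ 1) (hc₁1 : c₁ ≤ 1) (ks : List HComp) (hne : ks ≠ [])
    (hadm : ∀ k ∈ ks, HComp.Adm p c₁ k) (hA : ks.Pairwise (fun j k => j.A ≤ k.A)) (hc : ks.Pairwise (fun j k => k.c ≤ j.c))
    (hσ : 1 ≤ sigW p ks) : 0 ≤ FW p c₁ ks := by
  by_cases hS : ∃ k ∈ ks, k.h = 1
  swap
  · -- no sure companion
    have hfin : ∀ k ∈ ks, k.h < 1 := fun k hk => lt_of_le_of_ne (hadm k hk).h_le (fun h1 => hS ⟨k, hk, h1⟩)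
    rw [FW_eq hfin]
    refine mul_nonneg (zW_pos hfin).le ?_
    have hne' : ks.map (HComp.toComp p) ≠ [] := by simpa using hne
    have := pairs_regimeA hp hp1 hc₁1 (ks.map (HComp.toComp p)) hne'
      (by intro k hk; obtain ⟨l, hl, rfl⟩ := List.mem_map.mp hk; exact (hadm l hl).toComp hc₁1 (hfin l hl))
      (List.pairwise_map.mpr (hA.imp (by intro a b h; exact h)))
      (List.pairwise_map.mpr (hc.imp (by intro a b h; exact h)))
      (by rw [sigS_map]; exact hσ)
    linarith
  obtain ⟨k, hkmem, hk1⟩ := hS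
  obtain ⟨js, ls, rfl⟩ := List.append_of_mem hkmem
  have hk := hadm k hkmem
  by_cases h2 : ∃ l ∈ js ++ ls, l.h = 1
  · -- at least two sure companions
    have hz : zW (js ++ k :: ls) = 0 := zW_eq_zero hkmem hk1
    have hp1' := p1W_two_sure k hk1 js ls h2
    have hp2 := p2W_nonneg hc₁1 hadm hc
    simp only [FW, hz, hp1']; linarith
  -- exactly one sure companion `k`
  have hjs : ∀ m ∈ js, m.h < 1 := fun m hm => lt_of_le_of_ne (hadm m (by simp [hm])).h_le (fun h1 => h2 ⟨m, by simp [hm], h1⟩)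
  have hls : ∀ m ∈ ls, m.h < 1 := fun m hm => lt_of_le_of_ne (hadm m (by simp [hm])).h_le (fun h1 => h2 ⟨m, by simp [hm], h1⟩)
  rw [FW_one_sure k hk1 ls hls js hjs]
  refine mul_nonneg (mul_nonneg (zW_pos hjs).le (zW_pos hls).le) ?_
  rcases List.pairwise_append.mp hA with ⟨_, hAkls, _⟩
  rcases List.pairwise_cons.mp hAkls with ⟨hAk, _⟩
  rcases List.pairwise_append.mp hc with ⟨_, hckls, hccross⟩
  rcases List.pairwise_cons.mp hckls with ⟨hck, _⟩
  cases js with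
  | cons j js' =>
    exact sure_coeff_nonneg_of_nearer hp1 hc₁1 k hk (j :: js') ls hjs hls (by simp)
      (fun m hm => hadm m (by
        rcases List.mem_append.mp hm with h | h
        exacts [List.mem_append.mpr (Or.inl h), List.mem_append.mpr (Or.inr (List.mem_cons_of_mem _ h))]))
      (fun j' hj' => hccross j' hj' k (by simp)) hck
  | nil =>
    -- k is the nearest companion: Lemma C (σ ≥ 1)
    simp only [List.map_nil, List.sum_nil, zero_add]
    have hkd : 0 ≤ (k.toComp p).d p c₁ := hk.d_nonneg hc₁1
    have hkA0 : 0 ≤ (k.toComp p).A := hk.A_nonneg; have he : (k.toComp p).e = k.A * k.c := rfl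
    have hadm_ls : ∀ l ∈ ls.map (HComp.toComp p), Comp.Adm p c₁ l := by
      intro l hl; obtain ⟨m, hm, rfl⟩ := List.mem_map.mp hl; exact (hadm m (by simp [hm])).toComp hc₁1 (hls m hm)
    have hA_ls : ∀ l ∈ ls.map (HComp.toComp p), (k.toComp p).A ≤ l.A := by
      intro l hl; obtain ⟨m, hm, rfl⟩ := List.mem_map.mp hl; exact hAk m hm
    by_cases hls0 : ls = []
    · subst hls0
      -- k alone and sure: σ = ρ_k ≥ 1 forces (p + A) c = 0, hence e_k = 0
      simp only [List.map_nil, inc_nil, zero_sub, Left.nonneg_neg_iff]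
      simp only [List.nil_append, sigW_cons, sigW_nil, hk1, one_mul, add_zero, HComp.rho] at hσ
      have h1 : (p + k.A) * k.c ≤ 0 := by linarith
      have h2 : (p + k.A) * k.c = p * k.c + k.A * k.c := by ring
      nlinarith [mul_nonneg hp hk.c_nonneg]
    obtain ⟨l, ls', rfl⟩ := List.exists_cons_of_ne_nil hls0
    have hl := hadm_ls (l.toComp p) (by simp)
    have hC := lemmaC (k.toComp p) hkA0 hkd hp ((l :: ls').map (HComp.toComp p)) hadm_ls hA_ls
    have hT : (k.toComp p).T = (k.toComp p).rho p := by
      show k.h * k.rho p = 1 - (p + k.A) * k.c; simp [hk1, HComp.rho]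
    have hσ' : 1 ≤ (k.toComp p).rho p + sigS ((l :: ls').map (HComp.toComp p)) := by
      rw [sigS_map]; simp only [List.nil_append, sigW_cons, hk1, one_mul] at hσ
      show 1 ≤ (1 - (p + k.A) * k.c) + sigW p (l :: ls'); simpa [HComp.rho] using hσ
    have hp0 : 0 < p := by
      by_contra hp0
      have hpz : p = 0 := by linarith
      have h1 := hl.x_le_T; have h2 := T_lt_one hp (l.toComp p) hl
      have hx1 : xv p c₁ = 1 := by simp [xv, hpz]
      rw [hx1] at h1; linarith
    have hq' : 0 < p + (k.toComp p).A := by linarith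
    have : 0 ≤ (k.toComp p).A * (((k.toComp p).T + sigS ((l :: ls').map (HComp.toComp p)) - 1)
        + ((k.toComp p).rho p - (k.toComp p).T)) := mul_nonneg hkA0 (by rw [hT]; linarith)
    have hfin := (mul_nonneg_iff_of_pos_left hq').mp (le_trans this hC)
    rw [he] at hfin; linarith

end TwoArc

end Quant

end Summit.CriticalPhenomena.PercolationContinuityZ3.Theorems
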